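import Literature.Analysis.FluidPDE.StatisticalSolution
import Literature.Analysis.FluidPDE.EnergySpaceRellich
import Literature.Analysis.FluidPDE.SteadyNavierStokesProofs
import Literature.Analysis.FluidPDE.CylindricalGenerator
import Literature.Analysis.FunctionSpaces.TorusFluidGlueProofs
import Literature.Analysis.FunctionSpaces.TorusFourierCalculus
import Literature.Analysis.FunctionSpaces.TorusSobolevSpace

/-!
# Stub `stub_compactnessSplit` (S3) of line lojasiewicz-lamb-floor-ladder (crux stmt-AnomalousDissipation-13038)
# (`TaylorCertificates.SteadyStatesLoudBounded`)

RIGIDITY FROM THE ABSENCE OF ITS TWO ENEMIES.  For a smooth force `f` on `T³` and an energy level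
`E`: if (Q) every finite-enstrophy weak steady Euler state `v ∈ V` of `f`
(`Torus.IsSteadyWeakSolution 0 f v`) has `‖v‖² > E`, and (D) every bad sequence (smooth
admissible `u_n`, `∫|u_n|² ≤ E`, residual bounds `R_n ≥ 0` with `R_n → 0` and virtual dissipation
`R_n √(gradNormSq u_n) → 0`) has NON-divergent enstrophy, then "Lamb rigidity with a residual cap"
holds for some `c, δ₀ > 0`: admissible `u` with `∫|u|² ≤ E` and a residual bound `R ≤ δ₀` have
`c ≤ R √(gradNormSq u)`.

Proof (contrapositive + Rellich).  If no `(c, δ₀)` works, the choice `c = δ₀ = 1/(n+1)` produces a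
bad sequence; (D) gives a level `B` undershot infinitely often, hence
(`Filter.extraction_of_frequently_atTop`) a subsequence of enstrophy `≤ B`.  Its `H`-lifts
(`exists_lift`) lie in the norm-compact enstrophy ball `{eGradNormSq ≤ B}` of `H`
(`Torus.isCompact_setOf_eGradNormSq_le`; the spectral and classical enstrophies of a smooth field
agree, `Torus.eGradNormSq_eq_ofReal_gradNormSq`), so a further subsequence converges in `H` to some
`v` with `‖v‖² ≤ E` and `v ∈ V` (`memSobolev_one_complexify_of_eGradNormSq_ne_top`).  For each test
`w` the tested Euler generator `u ↦ (f, w) + ∫ (u ⊗ u) : ∇w` is norm-continuous on `H`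
(`continuous_nsGeneratorPairing`), and at the lift of a smooth admissible `u` it equals
`-∫⟪(u·∇)u − f, w⟫` (antisymmetry of the trilinear form, `Torus.integral_inner_convect_eq_neg`),
which is `≤ R_n √(gradNormSq w) → 0` in absolute value along the bad sequence.  Hence `v` is a weak
steady Euler state in the closed `E`-ball, contradicting (Q).

References: Foias–Manley–Rosa–Temam 2001, Ch. II §6 (Rellich on `H`), §7 (steady weak solutions);
Temam 1984, Ch. II §1.2 Lemma 1.3 (antisymmetry of `b`).  The lift glue is adapted from
`Cruxes/SteadyStatesLoudBounded/Disproof.lean` §1, §11.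
-/

-- `Summit.<Summit>.<Problem>` is the tree's mandated summit-side namespace (CONVENTIONS §2); single-conjunct summit, duplicate deliberate.
set_option linter.dupNamespace false

noncomputable section

namespace Summit.AnomalousDissipation.AnomalousDissipation.Theorems.SteadyStatesLoudBounded.CompactnessSplit

open MeasureTheory Filter Topology UnitAddTorus
open scoped InnerProductSpace ENNReal
open Literature.Analysis.FunctionSpaces Literature.Analysis.FluidPDE

/-! ## §1 `H`-lifts of smooth admissible fields (adapted from the crux's Disproof file, §1 and §11) -/

section Lift

open Literature.Analysis.FunctionSpaces.Torus Literature.Analysis.FluidPDE.Torus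

-- adapted from Cruxes/SteadyStatesLoudBounded/Disproof.lean §1 (`toH`, `coe_toH_ae_eq`)
/-- A smooth divergence-free mean-zero field has an `H`-lift: an element of `H` representing it
almost everywhere (its `L²` class lies in `𝒱 ⊆ H`). [folklore] -/
theorem exists_lift {u : UnitAddTorus (Fin 3) → EuclideanSpace ℝ (Fin 3)} (hu : IsSmooth u)
    (hdiv : IsDivFree u) (h0 : HasZeroMean u) :
    ∃ U : energySpace (Fin 3),
      (U.1 : UnitAddTorus (Fin 3) → EuclideanSpace ℝ (Fin 3)) =ᵐ[volume] u :=
  ⟨⟨MemLp.toLp u (hu.memLp 2),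
    smoothSolenoidal_subset_energySpace ⟨u, hu, hdiv, h0, MemLp.coeFn_toLp (hu.memLp 2)⟩⟩,
    MemLp.coeFn_toLp (hu.memLp 2)⟩

-- adapted from Cruxes/SteadyStatesLoudBounded/Disproof.lean §11 (`norm_sq_toH`)
/-- `‖U‖² = ∫‖u‖²` for an `H`-lift `U` of `u`. [folklore] -/
theorem norm_sq_of_lift {U : energySpace (Fin 3)} {u : UnitAddTorus (Fin 3) → EuclideanSpace ℝ (Fin 3)}
    (hU : (U.1 : UnitAddTorus (Fin 3) → EuclideanSpace ℝ (Fin 3)) =ᵐ[volume] u) :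
    ‖U‖ ^ 2 = ∫ x, ‖u x‖ ^ 2 := by
  rw [show ‖U‖ = ‖U.1‖ from rfl, ← real_inner_self_eq_norm_sq, MeasureTheory.L2.inner_def]
  refine integral_congr_ae ?_
  filter_upwards [hU] with x hx
  rw [hx, real_inner_self_eq_norm_sq]

/-- The spectral enstrophy of an `H`-lift of a smooth field `u` is the classical enstrophy
`∫ ∑ᵢ ‖∂ᵢu‖²` (`eGradNormSq` only sees the a.e. class; Parseval for smooth fields). [folklore] -/
theorem eGradNormSq_of_lift {U : energySpace (Fin 3)}
    {u : UnitAddTorus (Fin 3) → EuclideanSpace ℝ (Fin 3)} (hu : IsSmooth u)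
    (hU : (U.1 : UnitAddTorus (Fin 3) → EuclideanSpace ℝ (Fin 3)) =ᵐ[volume] u) :
    eGradNormSq (U.1 : UnitAddTorus (Fin 3) → EuclideanSpace ℝ (Fin 3)) =
      ENNReal.ofReal (gradNormSq u) := by
  rw [eGradNormSq_congr_ae_field hU, eGradNormSq_eq_ofReal_gradNormSq hu]

-- adapted from Cruxes/SteadyStatesLoudBounded/Disproof.lean §1 (`nsGeneratorPairing_toH`)
/-- **The tested Euler generator at an `H`-lift of a smooth admissible field is minus the item's
residual pairing**: `(f, w) + 0·(u, Δw) + ∫⟪Dw·u, u⟫ = -∫⟪(u·∇)u − f, w⟫` (antisymmetry of the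
trilinear form, `∫⟪(u·∇)w, u⟫ = -∫⟪(u·∇)u, w⟫`). [cite: Temam1984, Ch. II §1.2 Lemma 1.3] -/
theorem nsGeneratorPairing_zero_of_lift {f u w : UnitAddTorus (Fin 3) → EuclideanSpace ℝ (Fin 3)}
    {U : energySpace (Fin 3)} (hf : IsSmooth f) (hu : IsSmooth u) (hdiv : IsDivFree u)
    (hw : IsSmooth w) (hU : (U.1 : UnitAddTorus (Fin 3) → EuclideanSpace ℝ (Fin 3)) =ᵐ[volume] u) :
    nsGeneratorPairing 0 f U w = -∫ x, ⟪convect u u x - f x, w x⟫_ℝ := by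
  rw [nsGeneratorPairing, zero_mul, add_zero, inertialPairing]
  have h2 : ∫ x, ⟪Torus.fderiv w x ((U.1 : UnitAddTorus (Fin 3) → EuclideanSpace ℝ (Fin 3)) x),
      (U.1 : UnitAddTorus (Fin 3) → EuclideanSpace ℝ (Fin 3)) x⟫_ℝ = ∫ x, ⟪convect u w x, u x⟫_ℝ := by
    refine integral_congr_ae ?_
    filter_upwards [hU] with x hx
    rw [hx]
    rfl
  have h3 : ∫ x, ⟪convect u w x, u x⟫_ℝ = -∫ x, ⟪convect u u x, w x⟫_ℝ := by
    rw [integral_inner_convect_eq_neg hu hdiv hu hw, neg_neg]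
    exact integral_congr_ae (ae_of_all _ fun x => real_inner_comm _ _)
  have iC : Integrable (fun x => ⟪convect u u x, w x⟫_ℝ) volume :=
    ((hu.convect hu).inner hw).integrable
  have iF : Integrable (fun x => ⟪f x, w x⟫_ℝ) volume := (hf.inner hw).integrable
  rw [h2, h3]
  simp_rw [inner_sub_left]
  rw [integral_sub iC iF]
  ring

end Lift

/-! ## §2 The stub -/

open Literature.Analysis.FunctionSpaces.Torus Literature.Analysis.FluidPDE.Torus in
/-- **S3 `stub_compactnessSplit`** — rigidity with a residual cap from the absence of quiet
`V`-Euler states in the closed `E`-ball (Q) and of Onsager dodgers (D).  Contrapositive: a failing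
family `c = δ₀ = 1/(n+1)` is a bad sequence; (D) bounds its enstrophy along a subsequence; Rellich
in `H` (`Torus.isCompact_setOf_eGradNormSq_le`) extracts a limit `v ∈ V`, `‖v‖² ≤ E`, which by
norm-continuity of the tested Euler generator (`continuous_nsGeneratorPairing`) and
`nsGeneratorPairing_zero_of_lift` is a weak steady Euler state — enemy (Q). [folklore] -/
theorem stub_compactnessSplit :
    ∀ (f : UnitAddTorus (Fin 3) → EuclideanSpace ℝ (Fin 3)) (E : ℝ), Torus.IsSmooth f →
      (∀ u : Torus.energySpace (Fin 3),
        (u : Lp (EuclideanSpace ℝ (Fin 3)) 2 (volume : Measure (UnitAddTorus (Fin 3)))) ∈ Torus.energySpaceV (Fin 3) →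
        Torus.IsSteadyWeakSolution 0 f u → E < ‖u‖ ^ 2) →
      (∀ (u : ℕ → UnitAddTorus (Fin 3) → EuclideanSpace ℝ (Fin 3)) (R : ℕ → ℝ),
        (∀ n : ℕ, Torus.IsSmooth (u n) ∧ Torus.IsDivFree (u n) ∧ Torus.HasZeroMean (u n) ∧
          ∫ x, ‖u n x‖ ^ 2 ≤ E ∧ 0 ≤ R n ∧
          ∀ w : UnitAddTorus (Fin 3) → EuclideanSpace ℝ (Fin 3),
            Torus.IsSmooth w → Torus.IsDivFree w → Torus.HasZeroMean w →
            |∫ x, inner ℝ (Torus.convect (u n) (u n) x - f x) (w x)| ≤ R n * Real.sqrt (Torus.gradNormSq w)) →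
        Tendsto R atTop (𝓝 0) →
        Tendsto (fun n => R n * Real.sqrt (Torus.gradNormSq (u n))) atTop (𝓝 0) →
        ∃ B : ℝ, ∀ N : ℕ, ∃ n : ℕ, N ≤ n ∧ Torus.gradNormSq (u n) ≤ B) →
      ∃ c δ₀ : ℝ, 0 < c ∧ 0 < δ₀ ∧
        ∀ u : UnitAddTorus (Fin 3) → EuclideanSpace ℝ (Fin 3),
          Torus.IsSmooth u → Torus.IsDivFree u → Torus.HasZeroMean u → ∫ x, ‖u x‖ ^ 2 ≤ E →
          ∀ R : ℝ, 0 ≤ R →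
            (∀ w : UnitAddTorus (Fin 3) → EuclideanSpace ℝ (Fin 3),
              Torus.IsSmooth w → Torus.IsDivFree w → Torus.HasZeroMean w →
              |∫ x, inner ℝ (Torus.convect u u x - f x) (w x)| ≤ R * Real.sqrt (Torus.gradNormSq w)) →
            R ≤ δ₀ → c ≤ R * Real.sqrt (Torus.gradNormSq u) := by
  intro f E hf hQ hD
  by_contra hneg
  -- Step 1: a bad sequence from the failure of every `c = δ₀ = 1/(n+1)`
  have key : ∀ n : ℕ, ∃ (u : UnitAddTorus (Fin 3) → EuclideanSpace ℝ (Fin 3)) (R : ℝ),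
      IsSmooth u ∧ IsDivFree u ∧ HasZeroMean u ∧ ∫ x, ‖u x‖ ^ 2 ≤ E ∧ 0 ≤ R ∧
      (∀ w : UnitAddTorus (Fin 3) → EuclideanSpace ℝ (Fin 3), IsSmooth w → IsDivFree w →
        HasZeroMean w → |∫ x, ⟪convect u u x - f x, w x⟫_ℝ| ≤ R * Real.sqrt (gradNormSq w)) ∧
      R ≤ 1 / ((n : ℝ) + 1) ∧ R * Real.sqrt (gradNormSq u) < 1 / ((n : ℝ) + 1) := by
    intro n
    by_contra hn
    push Not at hn
    exact hneg ⟨1 / ((n : ℝ) + 1), 1 / ((n : ℝ) + 1), Nat.one_div_pos_of_nat,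
      Nat.one_div_pos_of_nat, fun u hu hd h0 hE R hR hb hδ => hn u R hu hd h0 hE hR hb hδ⟩
  choose u R hus hud huz huE hR0 hRb hRle hRG using key
  have hinv : Tendsto (fun n : ℕ => 1 / ((n : ℝ) + 1)) atTop (𝓝 0) :=
    tendsto_one_div_add_atTop_nhds_zero_nat
  have hRt : Tendsto R atTop (𝓝 0) := squeeze_zero hR0 hRle hinv
  have hRGt : Tendsto (fun n => R n * Real.sqrt (gradNormSq (u n))) atTop (𝓝 0) :=
    squeeze_zero (fun n => mul_nonneg (hR0 n) (Real.sqrt_nonneg _)) (fun n => (hRG n).le) hinv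
  -- Step 2: (D) bounds the enstrophy along a subsequence `φ`
  obtain ⟨B, hB⟩ := hD u R (fun n => ⟨hus n, hud n, huz n, huE n, hR0 n, hRb n⟩) hRt hRGt
  have hfreq : ∃ᶠ n in atTop, gradNormSq (u n) ≤ B := frequently_atTop.2 fun N => hB N
  obtain ⟨φ, hφ, hφB⟩ := extraction_of_frequently_atTop hfreq
  -- Step 3: the `H`-lifts lie in a compact enstrophy ball of `H`; extract a convergent subsequence
  choose U hU using fun n => exists_lift (hus n) (hud n) (huz n)
  set K : Set (energySpace (Fin 3)) :=
    {w | eGradNormSq (w.1 : UnitAddTorus (Fin 3) → EuclideanSpace ℝ (Fin 3)) ≤ ENNReal.ofReal B}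
    with hK
  have hKc : IsCompact K := isCompact_setOf_eGradNormSq_le ENNReal.ofReal_ne_top
  have hUK : ∀ n, U (φ n) ∈ K := fun n => by
    show eGradNormSq ((U (φ n)).1 : UnitAddTorus (Fin 3) → EuclideanSpace ℝ (Fin 3)) ≤
      ENNReal.ofReal B
    rw [eGradNormSq_of_lift (hus _) (hU _)]
    exact ENNReal.ofReal_le_ofReal (hφB n)
  obtain ⟨v₀, hv₀K, ψ, hψ, hlim⟩ := hKc.tendsto_subseq hUK
  -- Step 4: the limit lies in `V`, in the closed `E`-ball, and is a weak steady Euler state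
  have hV : v₀.1 ∈ energySpaceV (Fin 3) := ⟨v₀.2,
    memSobolev_one_complexify_of_eGradNormSq_ne_top (Lp.memLp _)
      (ne_top_of_le_ne_top ENNReal.ofReal_ne_top hv₀K)⟩
  have hE : ‖v₀‖ ^ 2 ≤ E := by
    have h1 : Tendsto (fun n => ‖U (φ (ψ n))‖ ^ 2) atTop (𝓝 (‖v₀‖ ^ 2)) :=
      ((continuous_norm.tendsto v₀).comp hlim).pow 2
    refine le_of_tendsto' h1 fun n => ?_
    rw [norm_sq_of_lift (hU _)]
    exact huE _
  have hsol : IsSteadyWeakSolution 0 f v₀ := by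
    intro w hw hwd hwm
    have hA : Tendsto (fun n => nsGeneratorPairing 0 f (U (φ (ψ n))) w) atTop
        (𝓝 (nsGeneratorPairing 0 f v₀ w)) :=
      ((continuous_nsGeneratorPairing 0 f hw).tendsto v₀).comp hlim
    have hB' : Tendsto (fun n => nsGeneratorPairing 0 f (U (φ (ψ n))) w) atTop (𝓝 0) := by
      have h0 : Tendsto (fun n => R (φ (ψ n)) * Real.sqrt (gradNormSq w)) atTop (𝓝 0) := by
        have h := (hRt.comp (hφ.tendsto_atTop.comp hψ.tendsto_atTop)).mul_const
          (Real.sqrt (gradNormSq w))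
        rw [zero_mul] at h
        exact h
      refine squeeze_zero_norm (fun n => ?_) h0
      rw [nsGeneratorPairing_zero_of_lift hf (hus _) (hud _) hw (hU _), norm_neg, Real.norm_eq_abs]
      exact hRb _ w hw hwd hwm
    exact tendsto_nhds_unique hA hB'
  -- Step 5: contradiction with (Q)
  exact absurd (hQ v₀ hV hsol) (not_lt.2 hE)

end Summit.AnomalousDissipation.AnomalousDissipation.Theorems.SteadyStatesLoudBounded.CompactnessSplit

end
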